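import Summits.ABC.IUTFork.Repair.RHLevelMover
import Summits.ABC.IUTFork.Repair.RHLinearReachLaw
import Summits.ABC.IUTFork.Cor312LicenceRealSharpMovers
import HarnessLib

/-!
# D-0079 RESCUE sub-cell R-H — the level mover through the BOX-FREE criterion at a prime with ONE place:
# «level weights» ⟹ `qRegion ⊆ ⁿ˒°𝒰_{j,p}`, and ROW 20's exact companion cell `ReachCell` as a kernel DOOR

PROOF-ONLY file (D-0012: 0 definitions, 0 `Prop` facts; abc-iut cell, rung LADDER-ABC:A2.RP → A2.RESCUE-H; seat abc-iut-rp-d3 gen 5,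
the LEVER named by abc-iut-rh-tst-7 2026-08-26T19:15:56Z item (iii) for ROUND 1 row 20 «linear-reach-law» (abc-iut-lens-control-1; typed by
abc-iut-rh-typ-7, `Repair/RHLinearReachLaw.lean` p463810)). TAKES NO SIDE on [IUTchIII] Cor. 3.12 or on any author; `ReachCell` /
`HReachCell` / `HStarLinearReachLaw` are R-H CANDIDATE vocabulary = HYPOTHESIS SHAPES, never asserted; typed ≠ proved; instantiated ≠
endorsed. Inputs BY NAME: this seat's `RHLevelMover.exists_mover_of_not_mem_logUnits` (p461981; abc-iut-w5-d180's (Ind2)-transitivity +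
campaign-S's compact open lattice `log_p(𝒪^×)`), abc-iut-w4-d087's BOX-FREE mover criterion
`Thm311.Real.qRegion_subset_thetaHull_settingPrVolSharp_of_movers` (`Cor312LicenceRealSharpMovers`: at a prime `p` carrying a UNIQUE place
`x₀` of `F` the sharp Θ-box is a polydisc in field-factor coordinates, so a pure tensor `⊗_a w_a` lies in it as soon as the PRODUCT
`Π_a ‖w_a‖ ≤ ‖t_{Θ,j,x₀}‖` — no per-slot `‖w_a‖ ≤ 1`), rh-typ-7's integer cell `RH.LinearReachLaw.ReachCell`.

* §1 `qRegion_subset_thetaHull_settingPrVolSharp_of_levelWeights` — at a unique-place prime `p`, label `j`: if `y ∉ Λ_{x₀} := log_p(𝒪_{x₀}^×)`,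
  `z ∈ Λ_{x₀}`, and integers `k_a` (`a ∈ S^±_{j+1}`) satisfy `Π_a p^{−(k_a+1)}·‖y‖ ≤ ‖t_{Θ,j,x₀}‖` and `‖t_{q,x₀}‖ ≤ Π_a p^{−k_a}·‖z‖`,
  then `qRegion j p ⊆ thetaHull j p` at `settingPrVolSharp`: the slot weights `w_a := p^{k_a+1}·y` satisfy `p^{−k_a−1}·w_a = y ∉ Λ`, so the
  level mover carries `w_a` to norm `≥ p^{−k_a}·‖z‖`, and the box-free criterion concludes.
* §2 `qRegion_subset_thetaHull_settingPrVolSharp_of_reachCell` — the same from rh-typ-7's `ReachCell e c B (i+1) m` (`∃ k, j²m ≤ e·k +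
  (j+1)(c+e−1) ∧ e·k + (j+1)·B ≤ m`, `j = i+1`) under the ONE-PLACE DICTIONARY: `‖ϖ‖ = p^{−1/e}`, a non-log-unit `y` with `‖y‖ ≤ ‖ϖ‖^{c−1}`
  (the inner conductor's minimality; `c ≥ 1` always, rh-typ-12 `RHSlotReach.exists_norm_le_one_not_mem_logUnits`), a log-unit `z` with
  `‖ϖ‖^B ≤ ‖z‖` (the outer order), realising norms `‖t_{q,x₀}‖ = ‖ϖ‖^m`, `‖t_{Θ,i+1,x₀}‖ = ‖ϖ‖^{(i+1)²m}` — all `k` on ONE slot, `0` on the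
  others. This is the EXACT companion cell `HReachCell`'s door (the hands instantiate `c, B` by `IsInnerConductor` / `IsOuterOrder`).
HONEST SCOPE: one-place packets only (`huniq`); OUR typed (Ind2) (Dupuy–Hilado, STRONGER-THAN-PRINT), SHARP boxes, hull-level Step (xi-f);
«the inclusion follows from the cell AS TYPED», nothing more. [cite: DupuyHilado2025, §3.7, §3.9, §4.9] [cite: WeilBNT1967, Ch. II §2, Th. 1]
[cite: Mochizuki2012, IUTchIII Cor. 3.12 Step (xi-f) p. 184] [claim: Mochizuki2012, status: disputed]
-/

noncomputable section

open Set Function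
open scoped Pointwise

namespace Summit.ABC.IUTFork.Repair.RHLevelMover

open Thm311 Thm311.Real Cor312 Cor312.Setting Cor312Vol Literature.IUT.LogThetaLattice Literature.IUT.LogVolume
open Literature.NumberTheory.NumberFields NumberField IsDedekindDomain Metric RH.LinearReachLaw

section Setting

variable {F : Type} [Field F] [NumberField F] (X : PilotData F) {logv : PadicLogs F} (hlog : LogvAnalytic logv)
  (M : Type) [Field M] [NumberField M]
  (archPk : ∀ (j : (thetaIndex X).Label) (vQ : (thetaIndex X).VQ), Set ((logShellsDH X logv).Packet j vQ))
  (archSub : ∀ (j : (thetaIndex X).Label) (v : (thetaIndex X).V),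
    Set ((logShellsDH X logv).Packet j ((thetaIndex X).over v)))
  (Ψ : ℤ → ∀ v : (thetaIndex X).V, v ∈ (thetaIndex X).Vbad → Set ((logShellsDH X logv).StarPacket v))
  (act : ℤ → ∀ v : (thetaIndex X).V, v ∈ (thetaIndex X).Vbad →
    (logShellsDH X logv).StarPacket v → Module.End ℚ ((logShellsDH X logv).StarPacket v))
  (Mmod : ℤ → ∀ j : (thetaIndex X).LabelStar, Set ((logShellsDH X logv).GlobalPacket j.1))
  (region : ℤ → ∀ j : (thetaIndex X).LabelStar, FinDivisor M → ∀ vQ : (thetaIndex X).VQ,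
    Set ((logShellsDH X logv).Packet j.1 vQ))
  (n : ℤ) {HT : Type} {LogLink : HT → HT → Type} {IsFull : ∀ {s t : HT}, LogLink s t → Prop}
  (lat : LGPGaussianLogThetaLattice LogLink IsFull)
  {Frd : Type} {IsoF : Frd → Frd → Type} {Ob : Frd → Type} {realify : Frd → Frd} {Strip : Type}
  {IsoS : Strip → Strip → Type} {Mv : ∀ v : (thetaIndex X).V, v ∈ (thetaIndex X).Vbad → Type}
  [∀ v h, Monoid (Mv v h)]
  (sig : GlobalLGPFrobenioidSignature (thetaIndex X).lstar (thetaIndex X).V (· ∈ (thetaIndex X).Vbad)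
    Frd IsoF Ob realify Strip IsoS Mv)
  (split : SplittingMonoids Mv) {ObΔ : Type} {N : ∀ v : (thetaIndex X).V, v ∈ (thetaIndex X).Vbad → Type}
  [∀ v h, Monoid (N v h)] (qData : QPilotData ObΔ N)
  (tq : ∀ (pp : Nat.Primes) (x : (thetaIndex X).Fibre (.inr pp)), haveI : Fact (pp : ℕ).Prime := ⟨pp.2⟩; kOf X pp.1 x)
  (t : ∀ (pp : Nat.Primes) (_ : Fin X.lstar) (x : (thetaIndex X).Fibre (.inr pp)),
    haveI : Fact (pp : ℕ).Prime := ⟨pp.2⟩; kOf X pp.1 x)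
  (htq0 : ∀ pp x, tq pp x ≠ 0)
  (htq1 : ∀ (pp : Nat.Primes) (x : (thetaIndex X).Fibre (.inr pp)),
    haveI : Fact (pp : ℕ).Prime := ⟨pp.2⟩; placeOf X pp.1 x ∉ X.S → ‖tq pp x‖ = 1)

/-! ## §1. Level weights ⟹ the inclusion, at a prime with a unique place -/

/-- **LEVEL WEIGHTS ⟹ `qRegion j p ⊆ thetaHull j p` at a prime carrying a UNIQUE place** (box-free: only the PRODUCT of the slot weights is
constrained). With `y ∉ log_p(𝒪_{x₀}^×) ∋ z` and integers `k_a`: `Π_a p^{−(k_a+1)}·‖y‖ ≤ ‖t_{Θ,j,x₀}‖` and `‖t_{q,x₀}‖ ≤ Π_a p^{−k_a}·‖z‖`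
give the inclusion, the slot `a` carrying `w_a := p^{k_a+1}·y` moved by the level mover to norm `≥ p^{−k_a}·‖z‖`.
[cite: DupuyHilado2025, §3.9, §4.9] [cite: WeilBNT1967, Ch. II §2, Th. 1] [claim: Mochizuki2012, status: disputed] -/
theorem qRegion_subset_thetaHull_settingPrVolSharp_of_levelWeights (ht0 : ∀ pp i x, t pp i x ≠ 0)
    (pp : Nat.Primes) (v₀ : HeightOneSpectrum (𝓞 F)) (hv₀ : (thetaIndex X).over (.inr v₀) = .inr pp)
    (huniq : ∀ x : (thetaIndex X).Fibre (.inr pp), x = ⟨.inr v₀, hv₀⟩) (j : (thetaIndex X).Label)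
    {y z : haveI : Fact (pp : ℕ).Prime := ⟨pp.2⟩; kOf X pp.1 ⟨.inr v₀, hv₀⟩}
    (hy : haveI : Fact (pp : ℕ).Prime := ⟨pp.2⟩;
      y ∉ (logUnits (kOf X pp.1 ⟨.inr v₀, hv₀⟩) : Set (kOf X pp.1 ⟨.inr v₀, hv₀⟩)))
    (hz : haveI : Fact (pp : ℕ).Prime := ⟨pp.2⟩;
      z ∈ (logUnits (kOf X pp.1 ⟨.inr v₀, hv₀⟩) : Set (kOf X pp.1 ⟨.inr v₀, hv₀⟩)))
    (k : (thetaIndex X).Caps j → ℤ)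
    (hw : haveI : Fact (pp : ℕ).Prime := ⟨pp.2⟩;
      ∏ a, ((pp : ℕ) : ℝ) ^ (-(k a + 1)) * ‖y‖ ≤ ‖labelIdele X t pp j ⟨.inr v₀, hv₀⟩‖)
    (hbig : haveI : Fact (pp : ℕ).Prime := ⟨pp.2⟩;
      ‖tq pp ⟨.inr v₀, hv₀⟩‖ ≤ ∏ a, ((pp : ℕ) : ℝ) ^ (-(k a)) * ‖z‖) :
    (settingPrVolSharp X hlog M archPk archSub Ψ act Mmod region n lat sig split qData tq t htq0 htq1).qRegion j (.inr pp) ⊆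
      (settingPrVolSharp X hlog M archPk archSub Ψ act Mmod region n lat sig split qData tq t htq0 htq1).thetaHull j (.inr pp) := by
  haveI hpF : Fact (pp : ℕ).Prime := ⟨pp.2⟩
  classical
  have hv : ((pp : ℕ) : 𝓞 F) ∈ v₀.asIdeal := natCast_mem_placeOf X pp.1 ⟨.inr v₀, hv₀⟩
  -- the slot weights `w_a = p^(k_a+1) • y` and their movers
  have hsu : ∀ a : (thetaIndex X).Caps j,
      (((pp : ℕ) : ℚ_[pp]) ^ (-(k a) - 1)) • ((((pp : ℕ) : ℚ_[pp]) ^ (k a + 1)) • y) = y := by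
    intro a
    rw [smul_smul, ← zpow_add₀ (Nat.cast_ne_zero.2 pp.2.ne_zero), show -(k a) - 1 + (k a + 1) = 0 by ring, zpow_zero,
      one_smul]
  have hmov : ∀ a : (thetaIndex X).Caps j, ∃ g ∈ ismDH logv (.inr v₀),
      ((pp : ℕ) : ℝ) ^ (-(k a)) * ‖z‖ ≤ ‖toR pp.1 v₀ hv (g (ofR pp.1 v₀ hv ((((pp : ℕ) : ℚ_[pp]) ^ (k a + 1)) • y)))‖ :=
    fun a => exists_mover_of_not_mem_logUnits (hlog pp) v₀ hv (hsu a) hy hz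
  choose g hg hreach using hmov
  refine qRegion_subset_thetaHull_settingPrVolSharp_of_movers X hlog M archPk archSub Ψ act Mmod region n lat sig split qData tq t htq0
    htq1 ht0 pp v₀ hv₀ huniq j (fun m => if h : m < (j : ℕ) + 1 then g ⟨m, h⟩ else LinearEquiv.refl ℚ _) (fun m => ?_)
    (fun a x => (huniq x).symm ▸ ((((pp : ℕ) : ℚ_[pp]) ^ (k a + 1)) • y)) ?_ ?_
  · -- the movers lie in `Ism^{DH}`
    show (if h : m < (j : ℕ) + 1 then g ⟨m, h⟩ else LinearEquiv.refl ℚ _) ∈ ismDH logv (.inr v₀)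
    split_ifs with h
    · exact hg ⟨m, h⟩
    · exact refl_mem_ismDH logv _
  · -- the product of the weights fits the Θ-box (the transport along `huniq x₀ : x₀ = x₀` is the identity)
    refine le_trans (le_of_eq (Finset.prod_congr rfl fun a _ => ?_)) hw
    show ‖((((pp : ℕ) : ℚ_[pp]) ^ (k a + 1)) • y)‖ = _
    rw [norm_zpow_prime_smul]
  · -- the reached product dominates `t_q`
    refine hbig.trans (Finset.prod_le_prod (fun a _ => by positivity) fun a _ => ?_)
    have hga : (if h : (a : ℕ) < (j : ℕ) + 1 then g ⟨a, h⟩ else LinearEquiv.refl ℚ _) = g a := by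
      rw [dif_pos a.isLt]
    show ((pp : ℕ) : ℝ) ^ (-(k a)) * ‖z‖ ≤
      ‖toR pp.1 v₀ hv ((if h : (a : ℕ) < (j : ℕ) + 1 then g ⟨a, h⟩ else LinearEquiv.refl ℚ _)
        (ofR pp.1 v₀ hv ((((pp : ℕ) : ℚ_[pp]) ^ (k a + 1)) • y)))‖
    rw [hga]
    exact hreach a

/-! ## §2. Row 20's exact companion cell `ReachCell` as a door -/

/-- **`ReachCell` ⟹ `qRegion (i+1) p ⊆ thetaHull (i+1) p` at a prime carrying a UNIQUE (bad) place**, under the ONE-PLACE DICTIONARY: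
`‖ϖ‖ = p^{−1/e}`, a non-log-unit `y` with `‖y‖ ≤ ‖ϖ‖^{c−1}` (inner conductor `c`, from its minimality), a log-unit `z` with `‖ϖ‖^B ≤ ‖z‖`
(outer order `B`), realising norms `‖t_{q,x₀}‖ = ‖ϖ‖^m`, `‖t_{Θ,i+1,x₀}‖ = ‖ϖ‖^{(i+1)²·m}`. The cell's content `k` goes on ONE slot.
This is the door abc-iut-rh-tst-7 asked for (row 20's `HReachCell`; the hands instantiate `c, B` by `IsInnerConductor` / `IsOuterOrder`).
[cite: DupuyHilado2025, §3.9, §4.9] [cite: WeilBNT1967, Ch. II §2, Th. 1] [claim: Mochizuki2012, status: disputed] -/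
theorem qRegion_subset_thetaHull_settingPrVolSharp_of_reachCell (ht0 : ∀ pp i x, t pp i x ≠ 0)
    (pp : Nat.Primes) (v₀ : HeightOneSpectrum (𝓞 F)) (hv₀ : (thetaIndex X).over (.inr v₀) = .inr pp)
    (huniq : ∀ x : (thetaIndex X).Fibre (.inr pp), x = ⟨.inr v₀, hv₀⟩) (i : Fin (thetaIndex X).lstar)
    (e c : ℕ) (he : 1 ≤ e) (B m : ℤ)
    {ϖ y z : haveI : Fact (pp : ℕ).Prime := ⟨pp.2⟩; kOf X pp.1 ⟨.inr v₀, hv₀⟩}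
    (hϖ : haveI : Fact (pp : ℕ).Prime := ⟨pp.2⟩; ‖ϖ‖ = ((pp : ℕ) : ℝ) ^ (-(1 : ℝ) / (e : ℝ)))
    (hy : haveI : Fact (pp : ℕ).Prime := ⟨pp.2⟩;
      y ∉ (logUnits (kOf X pp.1 ⟨.inr v₀, hv₀⟩) : Set (kOf X pp.1 ⟨.inr v₀, hv₀⟩)))
    (hyc : haveI : Fact (pp : ℕ).Prime := ⟨pp.2⟩; ‖y‖ ≤ ‖ϖ‖ ^ ((c : ℤ) - 1))
    (hz : haveI : Fact (pp : ℕ).Prime := ⟨pp.2⟩;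
      z ∈ (logUnits (kOf X pp.1 ⟨.inr v₀, hv₀⟩) : Set (kOf X pp.1 ⟨.inr v₀, hv₀⟩)))
    (hzB : haveI : Fact (pp : ℕ).Prime := ⟨pp.2⟩; ‖ϖ‖ ^ B ≤ ‖z‖)
    (hq : haveI : Fact (pp : ℕ).Prime := ⟨pp.2⟩; ‖tq pp ⟨.inr v₀, hv₀⟩‖ = ‖ϖ‖ ^ m)
    (hΘ : haveI : Fact (pp : ℕ).Prime := ⟨pp.2⟩; ‖t pp i ⟨.inr v₀, hv₀⟩‖ = ‖ϖ‖ ^ ((((i : ℕ) + 1 : ℕ) : ℤ) ^ 2 * m))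
    (hcell : ReachCell (e : ℤ) (c : ℤ) B ((i : ℕ) + 1) m) :
    (settingPrVolSharp X hlog M archPk archSub Ψ act Mmod region n lat sig split qData tq t htq0 htq1).qRegion (Setting.labelSucc i)
        (.inr pp) ⊆
      (settingPrVolSharp X hlog M archPk archSub Ψ act Mmod region n lat sig split qData tq t htq0 htq1).thetaHull (Setting.labelSucc i)
        (.inr pp) := by
  haveI hpF : Fact (pp : ℕ).Prime := ⟨pp.2⟩
  classical
  have hp1 : (1 : ℝ) < (pp : ℕ) := by exact_mod_cast pp.2.one_lt
  have hp0 : (0 : ℝ) < (pp : ℕ) := by positivity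
  have he0 : (0 : ℝ) < (e : ℝ) := by exact_mod_cast he
  obtain ⟨K, hK1, hK2⟩ := hcell
  -- uniformizer powers as `p`-powers
  have hϖpos : 0 < ‖ϖ‖ := by rw [hϖ]; exact Real.rpow_pos_of_pos hp0 _
  have hϖzpow : ∀ m : ℤ, ‖ϖ‖ ^ m = ((pp : ℕ) : ℝ) ^ (-(m : ℝ) / (e : ℝ)) := by
    intro m
    rw [← Real.rpow_intCast, hϖ, ← Real.rpow_mul hp0.le]
    congr 1; ring
  -- the number of slots is `i + 2`
  have hcard : (Finset.univ : Finset ((thetaIndex X).Caps (Setting.labelSucc i))).card = (i : ℕ) + 2 := by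
    rw [Finset.card_univ, Fintype.card_fin]; rfl
  -- all the content on the slot `0`
  let k : (thetaIndex X).Caps (Setting.labelSucc i) → ℤ := fun a => if a = 0 then K else 0
  have hksum : ∀ f : ℤ → ℤ, ∏ a, ((pp : ℕ) : ℝ) ^ (f (k a)) =
      ((pp : ℕ) : ℝ) ^ (f K) * (((pp : ℕ) : ℝ) ^ (f 0)) ^ ((i : ℕ) + 1) := by
    intro f
    rw [← Finset.mul_prod_erase Finset.univ _ (Finset.mem_univ (0 : (thetaIndex X).Caps (Setting.labelSucc i)))]
    have h0 : k 0 = K := if_pos rfl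
    rw [h0]
    congr 1
    rw [Finset.prod_congr rfl fun a ha => by rw [show k a = 0 from if_neg (Finset.ne_of_mem_erase ha)],
      Finset.prod_const, Finset.card_erase_of_mem (Finset.mem_univ _), hcard]
    rfl
  have hK1' : ((((i : ℕ) : ℝ) + 1) ^ 2) * (m : ℝ) ≤ (e : ℝ) * K + (((i : ℕ) : ℝ) + 1 + 1) * ((c : ℝ) + e - 1) := by
    exact_mod_cast hK1
  have hK2' : (e : ℝ) * K + (((i : ℕ) : ℝ) + 1 + 1) * (B : ℝ) ≤ m := by exact_mod_cast hK2
  refine qRegion_subset_thetaHull_settingPrVolSharp_of_levelWeights X hlog M archPk archSub Ψ act Mmod region n lat sig split qData tq t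
    htq0 htq1 ht0 pp v₀ hv₀ huniq (Setting.labelSucc i) hy hz k ?_ ?_
  · -- Θ-box: `Π p^{-(k_a+1)}·‖y‖ = p^{-(K+1)}·(p^{-1})^{i+1}·‖y‖^{i+2} ≤ ‖t_Θ‖ = p^{-(i+1)²m/e}`
    rw [labelIdele_labelSucc, hΘ, hϖzpow, Finset.prod_mul_distrib, Finset.prod_const, hcard, hksum fun x => -(x + 1)]
    have hyc' : ‖y‖ ≤ ((pp : ℕ) : ℝ) ^ (-(((c : ℤ) - 1 : ℤ) : ℝ) / (e : ℝ)) := by rw [← hϖzpow]; exact hyc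
    have hyle : ‖y‖ ^ ((i : ℕ) + 2) ≤ (((pp : ℕ) : ℝ) ^ (-(((c : ℤ) - 1 : ℤ) : ℝ) / (e : ℝ))) ^ ((i : ℕ) + 2) :=
      pow_le_pow_left₀ (norm_nonneg _) hyc' _
    have e1 : ((pp : ℕ) : ℝ) ^ (-(K + 1)) = ((pp : ℕ) : ℝ) ^ (-((K : ℝ) + 1)) := by
      rw [← Real.rpow_intCast]; push_cast; ring_nf
    have e2 : (((pp : ℕ) : ℝ) ^ (-((0 : ℤ) + 1))) ^ ((i : ℕ) + 1) = ((pp : ℕ) : ℝ) ^ ((((i : ℕ) : ℝ) + 1) * (-1)) := by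
      rw [← Real.rpow_intCast, ← Real.rpow_natCast, ← Real.rpow_mul hp0.le]
      congr 1; push_cast; ring
    have e3 : (((pp : ℕ) : ℝ) ^ (-(((c : ℤ) - 1 : ℤ) : ℝ) / (e : ℝ))) ^ ((i : ℕ) + 2) =
        ((pp : ℕ) : ℝ) ^ ((((i : ℕ) : ℝ) + 2) * (-((c : ℝ) - 1) / (e : ℝ))) := by
      rw [← Real.rpow_natCast, ← Real.rpow_mul hp0.le]
      congr 1; push_cast; ring
    calc ((pp : ℕ) : ℝ) ^ (-(K + 1)) * (((pp : ℕ) : ℝ) ^ (-((0 : ℤ) + 1))) ^ ((i : ℕ) + 1) * ‖y‖ ^ ((i : ℕ) + 2)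
        ≤ ((pp : ℕ) : ℝ) ^ (-(K + 1)) * (((pp : ℕ) : ℝ) ^ (-((0 : ℤ) + 1))) ^ ((i : ℕ) + 1) *
            (((pp : ℕ) : ℝ) ^ (-(((c : ℤ) - 1 : ℤ) : ℝ) / (e : ℝ))) ^ ((i : ℕ) + 2) := by gcongr
      _ = ((pp : ℕ) : ℝ) ^ ((-((K : ℝ) + 1)) + ((((i : ℕ) : ℝ) + 1) * (-1))
            + ((((i : ℕ) : ℝ) + 2) * (-((c : ℝ) - 1) / (e : ℝ)))) := by
          rw [e1, e2, e3, ← Real.rpow_add hp0, ← Real.rpow_add hp0]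
      _ ≤ ((pp : ℕ) : ℝ) ^ (-(((((i : ℕ) + 1 : ℕ) : ℤ) ^ 2 * m : ℤ) : ℝ) / (e : ℝ)) := by
          refine Real.rpow_le_rpow_of_exponent_le hp1.le ?_
          rw [le_div_iff₀ he0]
          have hsplit : ((-((K : ℝ) + 1)) + ((((i : ℕ) : ℝ) + 1) * (-1))
              + ((((i : ℕ) : ℝ) + 2) * (-((c : ℝ) - 1) / (e : ℝ)))) * (e : ℝ)
              = -((e : ℝ) * K + (((i : ℕ) : ℝ) + 1 + 1) * ((c : ℝ) + e - 1)) := by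
            field_simp; ring
          rw [hsplit]; push_cast; nlinarith [hK1']
  · -- reach: `‖t_q‖ = p^{-m/e} ≤ p^{-K}·‖z‖^{i+2}` ⟸ `e·K + (i+2)·B ≤ m`
    rw [hq, hϖzpow, Finset.prod_mul_distrib, Finset.prod_const, hcard, hksum fun x => -x, neg_zero, zpow_zero, one_pow,
      mul_one]
    have hzB' : ((pp : ℕ) : ℝ) ^ (-(B : ℝ) / (e : ℝ)) ≤ ‖z‖ := by rw [← hϖzpow]; exact hzB
    have hzle : (((pp : ℕ) : ℝ) ^ (-(B : ℝ) / (e : ℝ))) ^ ((i : ℕ) + 2) ≤ ‖z‖ ^ ((i : ℕ) + 2) :=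
      pow_le_pow_left₀ (Real.rpow_nonneg hp0.le _) hzB' _
    have e1 : ((pp : ℕ) : ℝ) ^ (-K) = ((pp : ℕ) : ℝ) ^ (-(K : ℝ)) := by
      rw [← Real.rpow_intCast]; push_cast; ring_nf
    have e3 : (((pp : ℕ) : ℝ) ^ (-(B : ℝ) / (e : ℝ))) ^ ((i : ℕ) + 2) =
        ((pp : ℕ) : ℝ) ^ ((((i : ℕ) : ℝ) + 2) * (-(B : ℝ) / (e : ℝ))) := by
      rw [← Real.rpow_natCast, ← Real.rpow_mul hp0.le]
      congr 1; push_cast; ring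
    calc ((pp : ℕ) : ℝ) ^ (-((m : ℤ) : ℝ) / (e : ℝ))
        ≤ ((pp : ℕ) : ℝ) ^ (-(K : ℝ) + (((i : ℕ) : ℝ) + 2) * (-(B : ℝ) / (e : ℝ))) := by
          refine Real.rpow_le_rpow_of_exponent_le hp1.le ?_
          rw [div_le_iff₀ he0]
          have hsplit : (-(K : ℝ) + (((i : ℕ) : ℝ) + 2) * (-(B : ℝ) / (e : ℝ))) * (e : ℝ)
              = -((e : ℝ) * K + (((i : ℕ) : ℝ) + 1 + 1) * (B : ℝ)) := by
            field_simp; ring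
          rw [hsplit]; linarith
      _ = ((pp : ℕ) : ℝ) ^ (-K) * (((pp : ℕ) : ℝ) ^ (-(B : ℝ) / (e : ℝ))) ^ ((i : ℕ) + 2) := by
          rw [e1, e3, ← Real.rpow_add hp0]
      _ ≤ ((pp : ℕ) : ℝ) ^ (-K) * ‖z‖ ^ ((i : ℕ) + 2) := by gcongr

end Setting

end Summit.ABC.IUTFork.Repair.RHLevelMover

end
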